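import Mathlib.FieldTheory.IsAlgClosed.AlgebraicClosure
import Mathlib.Algebra.CharP.Defs
import Literature.AlgebraicGeometry.Motives.AbelianVariety
import Literature.AlgebraicGeometry.Motives.GoodReduction
import Literature.NumberTheory.EllipticCurves.NeronModel
import HarnessLib
import Literature.NumberTheory.DiophantineGeometry.AVGaloisModule
import Literature.NumberTheory.GaloisRepresentations.CrystallineOrdinaryShape
import Literature.NumberTheory.GaloisRepresentations.GaloisRep
import Literature.NumberTheory.GaloisRepresentations.LocalClassFieldTheoryProofs
import Literature.NumberTheory.GaloisRepresentations.WeilGroupDensityProofs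
import Literature.NumberTheory.GaloisRepresentations.SerreWeightShapeProofs
import Literature.NumberTheory.Automorphic.LieKolchin
import Literature.NumberTheory.Automorphic.AdicCompletionLocalField

/-!
# Good ordinary reduction of an abelian variety at a finite place

For an abelian variety `A` over a number field `K` (`Literature.AlgebraicGeometry.Motives.AbelianVariety`)
and a finite place `v` of `K` with residue characteristic `p`, `A` has **good ordinary
reduction at `v`** if it extends to an abelian scheme `𝒜` over the local ring `𝓞_{K,v}` (good
reduction, Serre–Tate §1) whose special fibre `𝒜_v`, an abelian variety over the residue field
`κ(v)`, is **ordinary**: its `p`-rank is `g = dim A`, i.e. `𝒜_v[p](κ̄(v)) ≅ (ℤ/p)^g`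
(Li–Oort, *Moduli of Supersingular Abelian Varieties*, §0.6: "`X` is ordinary
`⟺ X[p](k) ≅ (ℤ/pℤ)^{dim X}`", `k` algebraically closed). This is the hypothesis "good
ordinary reduction at `3` and `5`" of Ellenberg, *Serre's conjecture over `𝔽₉`* (Ann. of Math.
161 (2005)), Prop. 1.2, Prop. 1.3, Cor. 3.3, requested with the Hilbert–Blumenthal vocabulary
(`HilbertBlumenthalLevelThreeModuli`); everything here is for general abelian varieties.

All definitions are real, in Mathlib's scheme language, following the tree's Néron-model file
(`Literature.NumberTheory.EllipticCurves.NeronModel`: group schemes are objects of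
`Over (Spec R)` with a `GrpObj` instance; the generic fibre functor `genericFibre R K` is
monoidal, so generic fibres of group schemes are group schemes):

* `geomResidueField v = κ̄(v)`, an algebraic closure of Mathlib's residue field
  `κ(v) = v.asIdeal.ResidueField`, and `toGeomResidueField v : 𝓞_{K,v} → κ̄(v)` (the tree's
  `residueAt v` followed by `κ(v) → κ̄(v)`); `𝓞_{K,v}` is Mathlib's
  `IsDedekindDomain.HeightOneSpectrum.valuationSubringAtPrime K v`, as in
  `Literature.AlgebraicGeometry.Motives.HasGoodReductionAt`.
* `geomClosedPoint v : SchemeOver 𝓞_{K,v}` — the geometric closed point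
  `Spec κ̄(v) → Spec 𝓞_{K,v}`; for a model `𝒳 → Spec 𝓞_{K,v}`, the `𝓞_{K,v}`-morphisms
  `geomClosedPoint v ⟶ 𝒳` are exactly the `κ̄(v)`-points of the special fibre
  `𝒳 ×_{𝓞_{K,v}} κ(v)` (universal property of the fibre product), and for a group scheme `𝒳`
  they form a group (Mathlib's scoped `Hom.group`); `specialFibrePTorsionCard v 𝒳` is the
  number of those of order dividing `p = char κ(v)`.
* `IsAbelianSchemeModel A v 𝒜` — `𝒜 → Spec 𝓞_{K,v}` (a group scheme) is smooth of relative
  dimension `dim A`, proper, and its generic fibre is isomorphic to `A` *as a group scheme*: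
  an abelian-scheme model, i.e. good reduction at `v` in the sense of Serre–Tate §1 (the
  underlying scheme is then a smooth proper model: `IsAbelianSchemeModel.hasGoodReductionAt`
  recovers the tree's `HasGoodReductionAt A.X A.dim v`).
* `AbelianVariety.HasGoodOrdinaryReductionAt A v` — there is an abelian-scheme model at `v`
  whose special fibre has exactly `p ^ dim A` geometric `p`-torsion points.

## Not here

* *Multiplicative* (purely toric) reduction (Ellenberg Prop. 1.2/1.3: "good ordinary or
  multiplicative reduction"): it needs the identity component of the special fibre of the
  Néron model to be a torus, and Mathlib has no tori / `𝔾_m^g` as group schemes to compare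
  with; not defined rather than replaced by a surrogate.
* That the special fibre of an abelian-scheme model is an abelian variety of dimension `g`
  (geometric connectedness of the fibres of a proper smooth morphism with geometrically
  connected generic fibre, EGA IV 15.5.4), that the `p`-rank is at most `g`, independence of
  the model (uniqueness of the Néron model, tree fact
  `IsNeronModel.exists_iso_of_isNeronModel`), and the Galois-theoretic description of ordinary
  reduction (`T_p A|_{D_v}` has an unramified rank-`g` quotient) are theorems, not recorded.

## References

* K.-Z. Li, F. Oort, *Moduli of Supersingular Abelian Varieties*, LNM 1680 (1998), §0.6
  (`p`-rank; ordinary abelian varieties). [LiOort1998]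
* J.-P. Serre, J. Tate, *Good reduction of abelian varieties*, Ann. of Math. 88 (1968), §1
  (good reduction = extends to an abelian scheme over the local ring). [SerreTate1968]
* J. S. Ellenberg, *Serre's conjecture over `𝔽₉`*, Ann. of Math. 161 (2005), Prop. 1.2,
  Prop. 1.3, Cor. 3.3 (the hypothesis "good ordinary reduction"). [Ellenberg2005]
-/

noncomputable section

open CategoryTheory AlgebraicGeometry IsDedekindDomain IsDedekindDomain.HeightOneSpectrum
open scoped MonObj NumberField CategoryTheory.Obj
open Literature.AlgebraicGeometry.Motives (AbelianVariety SchemeOver residueAt)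
open Literature.NumberTheory.EllipticCurves (genericFibre)

namespace Literature.NumberTheory.DiophantineGeometry

variable {K : Type} [Field K] [NumberField K]

/-! ### The geometric special fibre of a model over `𝓞_{K,v}` -/

section SpecialFibre

variable (v : HeightOneSpectrum (𝓞 K))

/-- `κ̄(v)`: an algebraic closure of the residue field `κ(v) = v.asIdeal.ResidueField` of the
finite place `v` (Mathlib `AlgebraicClosure`). [folklore] -/
abbrev geomResidueField : Type :=
  AlgebraicClosure v.asIdeal.ResidueField

/-- The reduction map `𝓞_{K,v} → κ̄(v)`: the tree's `residueAt v : 𝓞_{K,v} → κ(v)` followed by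
`κ(v) → κ̄(v)` (Serre–Tate §1). [cite: SerreTate1968, §1] -/
def toGeomResidueField : valuationSubringAtPrime K v →+* geomResidueField v :=
  (algebraMap v.asIdeal.ResidueField (geomResidueField v)).comp (residueAt v)

/-- The **geometric closed point** `Spec κ̄(v) → Spec 𝓞_{K,v}` of the local ring at `v`, as an
`𝓞_{K,v}`-scheme. For a model `𝒳 → Spec 𝓞_{K,v}`, the `𝓞_{K,v}`-morphisms
`geomClosedPoint v ⟶ 𝒳` are the `κ̄(v)`-valued points of the special fibre `𝒳 ×_{𝓞_{K,v}} κ(v)`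
(universal property of the fibre product; Hartshorne II.3, "fibre"). [folklore] -/
def geomClosedPoint : SchemeOver (valuationSubringAtPrime K v) :=
  Over.mk (Spec.map (CommRingCat.ofHom (toGeomResidueField v)))

/-- The geometric points `𝒳_v(κ̄(v))` of the special fibre of a model `𝒳 → Spec 𝓞_{K,v}`:
`𝓞_{K,v}`-morphisms `Spec κ̄(v) → 𝒳`. For a group scheme `𝒳` this is a group (Mathlib's
scoped instance `Hom.group`: morphisms into a group object of the cartesian monoidal category
`Over (Spec 𝓞_{K,v})`), written multiplicatively. [folklore] -/
abbrev specialFibreGeomPoints (𝒳 : SchemeOver (valuationSubringAtPrime K v)) : Type :=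
  geomClosedPoint v ⟶ 𝒳

/-- The residue characteristic `p = char κ(v)` of the finite place `v` (Mathlib `ringChar`). [folklore] -/
abbrev residueChar : ℕ :=
  ringChar v.asIdeal.ResidueField

/-- The number `#𝒳_v[p](κ̄(v))` of geometric points of the special fibre of the group scheme
`𝒳 → Spec 𝓞_{K,v}` of order dividing the residue characteristic `p` (`P ^ p = 1` in the group
`𝒳_v(κ̄(v))`; `Nat.card`, so `0` if there are infinitely many, which does not happen for an
abelian scheme). For an abelian scheme with special fibre of dimension `g` this is `p ^ f`,
`f ≤ g` the `p`-rank (Li–Oort §0.6). [cite: LiOort1998, §0.6 (p-rank)] -/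
def specialFibrePTorsionCard (𝒳 : SchemeOver (valuationSubringAtPrime K v)) [GrpObj 𝒳] : ℕ :=
  Nat.card {P : specialFibreGeomPoints v 𝒳 // P ^ residueChar v = 1}

end SpecialFibre

/-! ### Abelian-scheme models and good ordinary reduction -/

section Ordinary

variable (A : AbelianVariety K) (v : HeightOneSpectrum (𝓞 K))

/-- `IsAbelianSchemeModel A v 𝒜`: the group scheme `𝒜 → Spec 𝓞_{K,v}` is an **abelian-scheme
model of `A` at `v`** — smooth of relative dimension `dim A`, proper, with generic fibre
`𝒜 ×_{𝓞_{K,v}} K` isomorphic to `A` as a group scheme over `K` (the generic fibre functor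
`genericFibre` of the tree's Néron-model file is monoidal, so `𝒜_K` is a group scheme). Its
existence is *good reduction at `v`* in the sense of Serre–Tate, §1 ("`A` has good reduction at
`v` if it is the generic fibre of an abelian scheme over `𝓞_v`"). [cite: SerreTate1968, §1] -/
structure IsAbelianSchemeModel (𝒜 : SchemeOver (valuationSubringAtPrime K v)) [GrpObj 𝒜] :
    Prop where
  /-- `𝒜 → Spec 𝓞_{K,v}` is smooth of relative dimension `dim A`. -/
  smooth : SmoothOfRelativeDimension A.dim 𝒜.hom
  /-- `𝒜 → Spec 𝓞_{K,v}` is proper. -/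
  isProper : IsProper 𝒜.hom
  /-- The generic fibre is isomorphic to `A` as a group scheme over `K`. -/
  exists_iso : ∃ e : (genericFibre (valuationSubringAtPrime K v) K).obj 𝒜 ≅ A.X, IsMonHom e.hom

variable {A v} in
/-- An abelian-scheme model is in particular a smooth proper model of the underlying variety:
`IsAbelianSchemeModel A v 𝒜` implies the tree's `HasGoodReductionAt A.X A.dim v`
(Serre–Tate §1). [cite: SerreTate1968, §1] -/
theorem IsAbelianSchemeModel.hasGoodReductionAt {𝒜 : SchemeOver (valuationSubringAtPrime K v)}
    [GrpObj 𝒜] (h : IsAbelianSchemeModel A v 𝒜) :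
    Literature.AlgebraicGeometry.Motives.HasGoodReductionAt A.X A.dim v := by
  obtain ⟨e, -⟩ := h.exists_iso
  exact ⟨⟨𝒜, e⟩, h.smooth, h.isProper⟩

end Ordinary

section OrdinaryDef

/-- **Good ordinary reduction at `v`.** The abelian variety `A` over the number field `K` has
good ordinary reduction at the finite place `v` (residue characteristic `p`) if it has an
abelian-scheme model `𝒜` over `𝓞_{K,v}` (`IsAbelianSchemeModel`, good reduction) whose special
fibre `𝒜_v` is an *ordinary* abelian variety: `#𝒜_v[p](κ̄(v)) = p ^ dim A`, i.e. the `p`-rank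
of the `g`-dimensional abelian variety `𝒜_v / κ(v)` is `g` (Li–Oort §0.6: "`X` is ordinary
`⟺ X[p](k) ≅ (ℤ/pℤ)^{dim X}`"; an elementary abelian `p`-group is determined by its order).
This is the hypothesis "good ordinary reduction" of Ellenberg Prop. 1.2 / Prop. 1.3 / Cor. 3.3.
(Independence of the chosen model follows from the uniqueness of Néron models; not used in the
definition.) This is a predicate on `(A, v)` (a definition, not an assertion), binders
explicit in the signature. [cite: LiOort1998, §0.6 (ordinary abelian variety)] -/
def _root_.Literature.AlgebraicGeometry.Motives.AbelianVariety.HasGoodOrdinaryReductionAt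
    (A : AbelianVariety K) (v : HeightOneSpectrum (𝓞 K)) : Prop :=
  ∃ (𝒜 : SchemeOver (valuationSubringAtPrime K v)) (_ : GrpObj 𝒜),
    IsAbelianSchemeModel A v 𝒜 ∧ specialFibrePTorsionCard v 𝒜 = residueChar v ^ A.dim

variable {A : AbelianVariety K} {v : HeightOneSpectrum (𝓞 K)}

/-- Good ordinary reduction is in particular good reduction (of the underlying variety, in the
sense of the tree's `HasGoodReductionAt A.X A.dim v`). [cite: SerreTate1968, §1] -/
theorem _root_.Literature.AlgebraicGeometry.Motives.AbelianVariety.HasGoodOrdinaryReductionAt.hasGoodReductionAt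
    (h : A.HasGoodOrdinaryReductionAt v) :
    Literature.AlgebraicGeometry.Motives.HasGoodReductionAt A.X A.dim v := by
  obtain ⟨𝒜, _, h𝒜, -⟩ := h
  exact h𝒜.hasGoodReductionAt

/-- Unfolding lemma for `HasGoodOrdinaryReductionAt`. [folklore] -/
theorem _root_.Literature.AlgebraicGeometry.Motives.AbelianVariety.hasGoodOrdinaryReductionAt_iff :
    A.HasGoodOrdinaryReductionAt v ↔
      ∃ (𝒜 : SchemeOver (valuationSubringAtPrime K v)) (_ : GrpObj 𝒜),
        IsAbelianSchemeModel A v 𝒜 ∧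
          Nat.card {P : geomClosedPoint v ⟶ 𝒜 // P ^ ringChar v.asIdeal.ResidueField = 1} =
            ringChar v.asIdeal.ResidueField ^ A.dim :=
  Iff.rfl

end OrdinaryDef

end Literature.NumberTheory.DiophantineGeometry

/-! ## Relocated from `Summits/Langlands/Langlands/Theorems/PhantomRMYoshidaStableYoshidaCongruenceTateModuleGreenberg.lean` (gate, accept-time relocation of cited facts) — Greenberg1991, LiOort1998, SerreTate1968GoodReduction, Shatz1986GroupSchemes -/

namespace Literature.NumberTheory.DiophantineGeometry

open CategoryTheory IsDedekindDomain
open scoped NumberField commutatorElement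
open Literature.NumberTheory.GaloisRepresentations
open Literature.AlgebraicGeometry.Motives (AbelianVariety)

/-- **The `p`-adic Tate module of an abelian variety with good ordinary reduction is ordinary**
(Serre–Tate, Tate, Grothendieck; Greenberg's formulation).  Let `B` be an abelian variety over a
number field `K`, `v` a finite place of `K` above the prime `p`, and suppose `B` has good ordinary
reduction at `v` (tree `AbelianVariety.HasGoodOrdinaryReductionAt`: `B` is the generic fibre of an
abelian scheme `𝒜` over `𝓞_{K,v}` [SerreTate1968GoodReduction, §1] whose special fibre has `p`-rank
`g = dim B`, i.e. `𝒜_v[p] ⊗ κ̄(v) ≅ μ_p^g × (ℤ/p)^g` [LiOort1998, §0.6]).  Then the connected–étale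
sequence `0 → 𝒢⁰ → 𝒢 → 𝒢^ét → 0` of the `p`-divisible group `𝒢 = 𝒜[p^∞]` over the completed
local ring has `𝒢^ét` étale of height `g` and `𝒢⁰` of height `g = dim 𝒢⁰`, so `(𝒢⁰)^D` is étale
(`dim G + dim G^D = ht G`) and `T_p(𝒢⁰) ≅ T_p((𝒢⁰)^D)^∨(1)` [Shatz1986GroupSchemes, §6–§7]:
on Tate modules, `V_p(B) = V_p(𝒢)` restricted to the decomposition group `Γ_{K_v} → Γ_K`
(tree `absGaloisRestrict K K_v`, `rationalTateRep`) contains the `Γ_{K_v}`-stable subspace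
`W = V_p(𝒢⁰)` of dimension `g` on which the inertia group `I_{K_v}` (tree `absInertia`) acts
through the `p`-adic cyclotomic character `χ_p` of `K_v` (tree `GaloisRep.cyclotomicCharacter`),
and `I_{K_v}` acts trivially on `V_p(B)/W = V_p(𝒢^ét)`.  In Greenberg's language: `V_p(B)` is an
ordinary `p`-adic representation at `v` with `F⁰ = V_p(B) ⊃ F¹ = W ⊃ F² = 0`, inertia acting on
`gr^i` by `χ_p^i` [Greenberg1991, §2: definition, and the example `F¹V_p(E) = T_p¹(E) ⊗ ℚ_p`,
`T_p¹(E) = ker (T_p(E) → T_p(Ē))`, for good ordinary reduction].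
[cite: Greenberg1991, §2 (ordinary p-adic representations; the filtration of the Tate module for good ordinary reduction)]
[cite: Shatz1986GroupSchemes, §6 (connected–étale sequence; dim G + dim G^D = ht G; T_p(G^D) ≅ T_p(G)^d(1)) and §7 (ordinary p-divisible groups)]
[cite: SerreTate1968GoodReduction, §1 (good reduction: abelian-scheme model over O_v)]
[cite: LiOort1998, §0.6 (ordinary ⟺ X[p] ⊗ k ≅ μ_p^g × (ℤ/p)^g)]
[topic NumberTheory/DiophantineGeometry]
[file NumberTheory/DiophantineGeometry/AbelianVarietyOrdinaryReduction] -/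
def ordinaryReduction_tateModule_filtration : Prop :=
  ∀ {K : Type} [Field K] [NumberField K] (B : AbelianVariety K) (v : HeightOneSpectrum (𝓞 K))
    (p : ℕ) [Fact p.Prime], ((p : ℕ) : 𝓞 K) ∈ v.asIdeal → B.HasGoodOrdinaryReductionAt v →
    ∃ W : Submodule ℚ_[p] (B.rationalTateModule p),
      Module.finrank ℚ_[p] W = B.dim ∧
      (∀ (τ : Field.absoluteGaloisGroup (v.adicCompletion K)), ∀ w ∈ W,
          B.rationalTateRep p (absGaloisRestrict K (v.adicCompletion K) τ) w ∈ W) ∧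
      (∀ τ ∈ absInertia (v.adicCompletion K), ∀ w ∈ W,
          B.rationalTateRep p (absGaloisRestrict K (v.adicCompletion K) τ) w =
            (((GaloisRep.cyclotomicCharacter (v.adicCompletion K) p τ : ℤ_[p]ˣ) : ℤ_[p]) : ℚ_[p]) •
              w) ∧
      (∀ τ ∈ absInertia (v.adicCompletion K), ∀ x : B.rationalTateModule p,
          B.rationalTateRep p (absGaloisRestrict K (v.adicCompletion K) τ) x - x ∈ W)

/-! ### Linear algebra: commuting `2 × 2` matrices over an algebraically closed field -/

end Literature.NumberTheory.DiophantineGeometry
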